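import Literature.NumberTheory.EllipticCurves.FunctionFieldEllipticLContinuationLeavesProofs
import Literature.NumberTheory.EllipticCurves.FunctionFieldPlacesGenusZeroProofs
import HarnessLib

/-!
# `L(E, s)` of a constant elliptic curve over `𝔽_q(T)` has an analytic continuation — unconditionally

Sibling proof file (D-0014: theorems only, sorry-free) in the provefact decomposition of
`Literature.NumberTheory.EllipticCurves.FunctionField.hasLContinuation` (gen 1). The corrected
fact `hasLContinuation_of_functionField Fq W` (Ulmer 2011, Lecture 1, §9: for an elliptic curve over
a global function field the Euler product `L(E, s)` "has a meromorphic continuation to all `s`" and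
"in all cases `L(E,s)` is holomorphic at `s = 1`") is reduced in the tree to two leaves
(`FunctionFieldEllipticLContinuationLeavesProofs.hasLContinuation_of_functionField_of_leaves`):
Weil's theorem for the base field `F` and Grothendieck–Deligne rationality for non-constant `E`
(Theorem 9.3). For a **constant** curve only the first leaf is needed
(`hasLContinuation_of_smul_eq_map`: Exercise 9.2, discharged in
`FunctionFieldEllipticLConstantProofs`, plus Hasse–Weil for `E₀/𝔽_q`, discharged in
`ZetaEllipticCurveFiniteFieldProofs`), and for the **rational function field** `F = 𝔽_q(T)` that
leaf is discharged in `FunctionFieldPlacesGenusZeroProofs` (`isGenus_ratFunc_zero`: genus `0`,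
`N_n = qⁿ + 1`). Hence the first unconditional instances of the fact:

* `HasLContinuation.of_smul_eq_map_ratFunc`, `HasLContinuation.of_isConstantCurve_ratFunc`: for an
  elliptic curve `E` over `𝔽_q(T)` which is constant (`E ≅ E₀ ×_{𝔽_q} 𝔽_q(T)`, i.e.
  `e • W = W₀ ⊗ 𝔽_q(T)` for an admissible change of variables `e`), the Euler product `L(E, s)`
  has a meromorphic continuation to `ℂ`, holomorphic at `s = 1` (`lContinuations W` is nonempty);
* `hasLContinuation_of_functionField_of_isConstantCurve_ratFunc`,
  `hasLContinuation_of_isConstantCurve_ratFunc`: the corrected fact and the original `Prop`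
  `hasLContinuation W`, at such `W`.

By Ulmer's Exercise 9.2 with `g_𝒞 = 0` the continuation is in fact
`L(E, s) = 1 / (∏ᵢ (1 - αᵢ q^{-s}) ∏ᵢ (1 - αᵢ q^{1-s}))`, `#E₀(𝔽_{qⁿ}) = qⁿ + 1 - α₁ⁿ - α₂ⁿ`
(`ellLFunction_eq_of_smul_eq_map_ratFunc`), with poles on `Re s = 1/2` and `Re s = 3/2` only.

## References

* [Ulmer2011ParkCity] D. Ulmer, *Elliptic curves over function fields*, IAS/Park City Math. Ser. 18
  (2011), Lecture 1, §9, Exercise 9.2 and Theorem 9.3 (arXiv:1101.1939, p. 18).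
* [RosenFunctionFields2002] M. Rosen, *Number Theory in Function Fields*, GTM 210, Ch. 5, pp. 50, 52
  (genus and zeta function of `𝔽(T)`).
* [SilvermanAEC2009] J. H. Silverman, *The Arithmetic of Elliptic Curves*, 2nd ed., Thm. V.2.3.1.
-/

noncomputable section

open scoped Polynomial

namespace Literature.NumberTheory.EllipticCurves.FunctionField

variable (Fq : Type) [Field Fq] [Fintype Fq]

/-- **`L(E, s)` continues, for a constant elliptic curve over `𝔽_q(T)`** (unconditional): if
`e • W = W₀ ⊗ 𝔽_q(T)` for an admissible change of variables `e` over `𝔽_q(T)` and a Weierstrass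
curve `W₀` over `𝔽_q`, then `HasLContinuation W` — the Euler product `L(E, s)` over all places of
`𝔽_q(T)` has a meromorphic continuation to `ℂ`, holomorphic at `s = 1`. Ulmer (2011), Lecture 1,
Exercise 9.2 ("Thus `L(E,s)` is a rational function in `q^{-s}` … it extends to a meromorphic
function of `s` … Its poles lie on the lines `Re s = 1/2` and `Re s = 3/2`") with `g_𝒞 = 0` for
`𝒞 = ℙ¹` (Rosen Ch. 5, p. 50), via `hasLContinuation_of_smul_eq_map` fed with the discharged facts
`isFullConstantField_ratFunc`, `isGenus_ratFunc_zero`, `WeierstrassCurve.card_point_baseChange_eq_holds`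
(Hasse–Weil for `E₀`) and `ellLFunction_eq_div_of_isConstantCurve_holds` (Exercise 9.2).
[cite: Ulmer2011ParkCity, Lect. 1, §9, Exercise 9.2] -/
theorem HasLContinuation.of_smul_eq_map_ratFunc (W : WeierstrassCurve (RatFunc Fq)) [W.IsElliptic]
    {W₀ : WeierstrassCurve Fq} {e : WeierstrassCurve.VariableChange (RatFunc Fq)}
    (he : e • W = W₀.map ((algebraMap Fq[X] (RatFunc Fq)).comp Polynomial.C)) :
    HasLContinuation W :=
  hasLContinuation_of_smul_eq_map Fq W (isFullConstantField_ratFunc Fq) (isGenus_ratFunc_zero Fq) he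
    (WeierstrassCurve.card_point_baseChange_eq_holds W₀)
    (ellLFunction_eq_div_of_isConstantCurve_holds Fq W₀ W)

/-- `HasLContinuation W` for every constant elliptic curve `W` over `𝔽_q(T)`
(`IsConstantCurve Fq W`: some admissible change of variables makes `W` the base change of a curve
over `𝔽_q`; Ulmer (2011), Lecture 1, §1 and Exercise 9.2). Unconditional.
[cite: Ulmer2011ParkCity, Lect. 1, §9, Exercise 9.2] -/
theorem HasLContinuation.of_isConstantCurve_ratFunc (W : WeierstrassCurve (RatFunc Fq)) [W.IsElliptic]
    (hW : IsConstantCurve Fq W) : HasLContinuation W := by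
  obtain ⟨W₀, e, he⟩ := hW
  exact HasLContinuation.of_smul_eq_map_ratFunc Fq W he

/-- The corrected fact `hasLContinuation_of_functionField Fq W` of `FunctionFieldEllipticL`
(Ulmer (2011), Lecture 1, §9: meromorphic continuation of `L(E, s)` to all `s`, holomorphic at
`s = 1`) holds unconditionally for constant curves over the rational function field `𝔽_q(T)`.
[cite: Ulmer2011ParkCity, Lect. 1, §9, Exercise 9.2] -/
theorem hasLContinuation_of_functionField_of_isConstantCurve_ratFunc
    (W : WeierstrassCurve (RatFunc Fq)) (hW : IsConstantCurve Fq W) :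
    hasLContinuation_of_functionField Fq W := by
  intro _
  exact HasLContinuation.of_isConstantCurve_ratFunc Fq W hW

/-- The original `Prop` `hasLContinuation W` of `FunctionFieldEllipticL` (the provefact target,
definitionally `hasLContinuation_of_functionField Fq W` at a global function field) holds
unconditionally for constant curves over `𝔽_q(T)`. [cite: Ulmer2011ParkCity, Lect. 1, §9, Exercise 9.2] -/
theorem hasLContinuation_of_isConstantCurve_ratFunc (W : WeierstrassCurve (RatFunc Fq))
    (hW : IsConstantCurve Fq W) : hasLContinuation W :=
  hasLContinuation_of_hasLContinuation_of_functionField Fq W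
    (hasLContinuation_of_functionField_of_isConstantCurve_ratFunc Fq W hW)

/-- In particular the base change `W₀ ⊗ 𝔽_q(T)` of an elliptic curve over `𝔽_q` has
`HasLContinuation`. [cite: Ulmer2011ParkCity, Lect. 1, §9, Exercise 9.2] -/
theorem HasLContinuation.map_ratFunc (W₀ : WeierstrassCurve Fq) [W₀.IsElliptic] :
    HasLContinuation (W₀.map ((algebraMap Fq[X] (RatFunc Fq)).comp Polynomial.C)) := by
  haveI : (W₀.map ((algebraMap Fq[X] (RatFunc Fq)).comp Polynomial.C)).IsElliptic := by
    infer_instance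
  exact HasLContinuation.of_isConstantCurve_ratFunc Fq _ (isConstantCurve_map Fq W₀)

/-- **Ulmer's Exercise 9.2 over `𝔽_q(T)`, explicitly**: for a constant elliptic curve
`E ≅ E₀ × 𝔽_q(T)` over the rational function field (genus `0`, no `β_j`), on `Re s > 3/2`
`L(E, s) = 1 / (∏ᵢ (1 - αᵢ q^{-s}) · ∏ᵢ (1 - αᵢ q^{1-s}))`, where `#E₀(𝔽_{qⁿ}) = qⁿ + 1 - α₁ⁿ - α₂ⁿ`,
`α₁ α₂ = q`, `|αᵢ| = √q` (Hasse–Weil, Silverman V.2.3.1): the numerator `∏_{i,j} (1 - αᵢβⱼq^{-s})`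
of Exercise 9.2 is an empty product. [cite: Ulmer2011ParkCity, Lect. 1, §9, Exercise 9.2] -/
theorem ellLFunction_eq_of_smul_eq_map_ratFunc (W : WeierstrassCurve (RatFunc Fq)) [W.IsElliptic]
    {W₀ : WeierstrassCurve Fq} {e : WeierstrassCurve.VariableChange (RatFunc Fq)}
    (he : e • W = W₀.map ((algebraMap Fq[X] (RatFunc Fq)).comp Polynomial.C)) :
    ∃ α : Fin 2 → ℂ, α 0 * α 1 = Fintype.card Fq ∧ (∀ i, ‖α i‖ = √(Fintype.card Fq : ℝ)) ∧
      (∀ (K : Type) [Field K] [Fintype K] [Algebra Fq K],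
        (Nat.card (W₀.baseChange K).toAffine.Point : ℂ) =
          (Fintype.card Fq : ℂ) ^ Module.finrank Fq K + 1 - ∑ i, α i ^ Module.finrank Fq K) ∧
      ∀ s : ℂ, (3 / 2 : ℝ) < s.re →
        ellLFunction W s =
          1 / ((∏ i, (1 - α i * (Fintype.card Fq : ℂ) ^ (-s))) *
            ∏ i, (1 - α i * (Fintype.card Fq : ℂ) ^ (1 - s))) := by
  haveI : W₀.IsElliptic := isElliptic_of_smul_eq_map he
  have hHW : W₀.card_point_baseChange_eq := WeierstrassCurve.card_point_baseChange_eq_holds W₀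
  obtain ⟨α, β, -, hprod, hα, hβ, hcount⟩ := hHW.exists_roots
  set αv : Fin 2 → ℂ := ![α, β] with hαv
  have hαnorm : ∀ i, ‖αv i‖ = √(Fintype.card Fq : ℝ) := by
    intro i; fin_cases i <;> simp [hαv, hα, hβ]
  have hcount' : ∀ (K : Type) [Field K] [Fintype K] [Algebra Fq K],
      (Nat.card (W₀.baseChange K).toAffine.Point : ℂ) =
        (Fintype.card Fq : ℂ) ^ Module.finrank Fq K + 1 - ∑ i, αv i ^ Module.finrank Fq K := by
    intro K _ _ _
    rw [hcount K, Fin.sum_univ_two]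
    simp [hαv]
    ring
  have hprod' : αv 0 * αv 1 = Fintype.card Fq := by simpa [hαv] using hprod
  obtain ⟨γ, hγ, hN⟩ := isGenus_ratFunc_zero Fq
  have hL := ellLFunction_eq_div_of_isConstantCurve_holds Fq W₀ W 0 αv γ
    (isFullConstantField_ratFunc Fq) ⟨e, he⟩ hcount' hprod' hαnorm hN hγ
  refine ⟨αv, hprod', hαnorm, hcount', fun s hs => ?_⟩
  rw [hL s hs]
  simp

end Literature.NumberTheory.EllipticCurves.FunctionField

end
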